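import Summits.CriticalPhenomena.PercolationContinuityZ3.Theorems.Transplant.SkelNegBParamsKitS
import Summits.CriticalPhenomena.PercolationContinuityZ3.Theorems.Transplant.SkelNegBChoiceAllS
import Summits.CriticalPhenomena.PercolationContinuityZ3.Theorems.Transplant.SkelPhiRunExitTable
import HarnessLib

/-!
# N1 params, chain of record `NegB`, part SlotsRS: THE (R)-SIDE SLOT VALUES AND THE ORIENTED KIT PAIR AT THE KIT-SLOT BLOCK `NegB.KS` (supersedes part SlotsR
# p292365, whose values read part K's `Mkit := 22·M_u+57`; p1-g11's exit table p293503 needs `24·M_z + 64 ≤ ℓ_kit`) — `KS.bR := D.k + 2·KS.RA' + 1` (Δ₀), `KS.mbR :=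
# max (2·bR + 26) (24·M_u + 63)`, the bridge at the values, `KS.oK/φK`, **`KS.oS := (oK == oL)` with `oriφ φL oS = φK`** (p1's `ShortPcO.oS`), **`KS.QKO : ShortPcO`**,
# and the three ledger facts of `pexXO_spec` at the kit pair (`22·M_u + 58 ≤ n_kit`, `|h_kit| ≤ 10·n_kit`, `24·M_u + 64 ≤ ℓ_kit`) out of `AtQO` of the S1 choices

builds on p205010 (kernel theorem, internal audit signed; external expert review pending) — nothing in this file uses p205010; NOTHING is claimed about
the node `SamePDropOfSkeletonNeg₁` (OPEN).
Status sentence (coordinator 2026-08-20T04:30Z): "θ(p_c) = 0 on ℤ^d, all d ≥ 2 — kernel-verified (Lean 4/Mathlib, standard axioms); internal adversarial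
audit SIGNED 2026-08-20 04:29Z; external expert review pending."
Lane `prim-bschramm-*`, seat `prim-bschramm-stmt` (gen 14); helper file (`--supports stmt-CriticalPhenomena-4575 --as helper`); ledger HOME/prim-bschramm-stmt/NEG-PARAMS.md v0.11.
* §1 `bR mbR` (+ `bR_eq`, `mbR_floors`), `MBR/nBR/hBR/ℓBR/vBR`, `bridgeR_adm`, **`RF2_R`**, **`MB_floorsR`** (`2bR+26 ≤ M_b`, `24M_u+63 ≤ M_b`, `M_u ≤ M_b`), `ℓBR_ge`; §1b `j₀A_ge`;
* §2 `oK/φK` (+ `lip/steps`), `trφ_trφ`, **`oS`**, **`oriφ_φL_oS`**, `clauseK_of_factsO`, `eqNumK_of_eqGeom`, **`ℓKit_ge`** (`24M_u+64 ≤ ℓ_kit`), **`QKO`** (+ `QKO_facts`, `RgO_QKO`);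
* §3 at `AtQO` (S1 choices `choiceAtOS`): **`clauseK_of_atQOS`**, `κK_int_of_atQOS`, **`pexXO_facts_of_atQOS`** (the three `pexXO_spec` facts at every centre), **`inputsK_of_atQOS`**,
  `clauseBR_of_atQOS`, `inputsBR_of_atQOS`.
[cite: KozmaNitzan2024, §4 Theorem 6 (pp. 25–31); Lemma 10 (pp. 18–21)] [cite: MartineauTassion2017, §3.2 Lemma 3.5]
-/

noncomputable section

open scoped Classical

namespace Summit.CriticalPhenomena.PercolationContinuityZ3.Theorems.Transplant

namespace PlanarSkeletonNeg

namespace NegB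

namespace KS

open MeasureTheory Literature.Probability.Percolation Literature.Probability.LatticeModels SimpleGraph
open SkelConc (Consts)
open Skelφ (oriφ trφ)
open Skelφ.StepI (DataN OutO)
open Neg

/-! ## §1 The bridge slot values at `R′ := KS.RA'` -/

section BridgeR

variable (κ : Consts) {V : Type} [Countable V] {G : SimpleGraph V} [G.LocallyFinite] (Φ : PlanarSkeletonNeg G) (t : V)
  (p : unitInterval) (D : DataN V) (mk : ℕ)

/-- **THE BRIDGE CLEARANCE OF RECORD** `b := Δ₀ := D.k + 2·R′ + 1` at `R′ := KS.RA'`. [this work] -/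
def bR : ℕ := D.k + 2 * RA' κ Φ t p D mk + 1

/-- **THE BRIDGE ZONE-INDEX FLOOR OF RECORD** `mb := max (2Δ₀ + 26) (24·M_u + 63)`. [this work] -/
def mbR : ℕ := max (2 * bR κ Φ t p D mk + 26) (24 * Mu D + 63)

/-- `bR = D.k + 2·RA' + 1`, `D.k ≤ bR`, `2·RA' + 1 ≤ bR`. [folklore] -/
theorem bR_eq : bR κ Φ t p D mk = D.k + 2 * RA' κ Φ t p D mk + 1 ∧ D.k ≤ bR κ Φ t p D mk ∧ 2 * RA' κ Φ t p D mk + 1 ≤ bR κ Φ t p D mk :=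
  ⟨rfl, by unfold bR; omega, by unfold bR; omega⟩

/-- `2·bR + 26 ≤ mbR` and `24·M_u + 63 ≤ mbR`. [folklore] -/
theorem mbR_floors : 2 * bR κ Φ t p D mk + 26 ≤ mbR κ Φ t p D mk ∧ 24 * Mu D + 63 ≤ mbR κ Φ t p D mk := ⟨le_max_left _ _, le_max_right _ _⟩

/-- The bridge zone index at the slot values. [this work] -/
abbrev MBR : ℕ := MB D (mbR κ Φ t p D mk)

/-- The bridge width at the slot values. [this work] -/
abbrev nBR : ℕ := nB D (mbR κ Φ t p D mk) (bR κ Φ t p D mk)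

/-- The bridge shear at the slot values. [this work] -/
abbrev hBR : ℤ := hB t D (mbR κ Φ t p D mk) (bR κ Φ t p D mk)

/-- The bridge half-length at the slot values. [this work] -/
abbrev ℓBR : ℕ := ℓB t D (mbR κ Φ t p D mk) (bR κ Φ t p D mk)

/-- The bridge split point at the slot values. [this work] -/
abbrev vBR : ℤ := vB t D (mbR κ Φ t p D mk) (bR κ Φ t p D mk)

/-- **The bridge pair at the slot values is admissible.** [folklore] -/
theorem bridgeR_adm : D.M₀ ≤ (MBR κ Φ t p D mk, nBR κ Φ t p D mk).1 ∧ D.n₁ (MBR κ Φ t p D mk, nBR κ Φ t p D mk).1 ≤ (MBR κ Φ t p D mk, nBR κ Φ t p D mk).2 :=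
  bridge_adm D _ _

/-- **(R-F2) at the values**: `bR ≤ n_b`, `M_b < n_b`, `M_b + bR + 2 + ρz ≤ n_b`. [folklore] -/
theorem RF2_R : bR κ Φ t p D mk ≤ nBR κ Φ t p D mk ∧ MBR κ Φ t p D mk < nBR κ Φ t p D mk ∧ MBR κ Φ t p D mk + bR κ Φ t p D mk + 2 + ρz D ≤ nBR κ Φ t p D mk :=
  ⟨(nB_facts D _ _).2.2.1, (nB_facts D _ _).2.1, (nB_facts D _ _).2.2.2⟩

/-- **The zone-index floors at the values**: `2·bR + 26 ≤ M_b`, `24·M_u + 63 ≤ M_b`, `M_u ≤ M_b`. [folklore] -/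
theorem MB_floorsR : 2 * bR κ Φ t p D mk + 26 ≤ MBR κ Φ t p D mk ∧ 24 * Mu D + 63 ≤ MBR κ Φ t p D mk ∧ Mu D ≤ MBR κ Φ t p D mk := by
  have h1 := (MB_facts D (mbR κ Φ t p D mk)).2.1
  have h2 := mbR_floors κ Φ t p D mk
  exact ⟨h2.1.trans h1, h2.2.trans h1, (MB_facts D _).1⟩

/-- **The one-stride room at the values**: `2·bR + 27 ≤ ℓ_b` (from `EqGeom` at the bridge pair, any map). [folklore] -/
theorem ℓBR_ge (ψ : V → Site 2) (hE : D.EqGeom G ψ t (MBR κ Φ t p D mk) (nBR κ Φ t p D mk)) : 2 * bR κ Φ t p D mk + 27 ≤ ℓBR κ Φ t p D mk := by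
  have h1 := ℓB_ge t D (mbR κ Φ t p D mk) (bR κ Φ t p D mk) ψ hE
  have h2 := (mbR_floors κ Φ t p D mk).1
  show _ ≤ ℓB t D (mbR κ Φ t p D mk) (bR κ Φ t p D mk)
  omega

end BridgeR

/-! ## §1b The first kit level against the apron's clamp -/

section Levels

variable {V : Type} {G : SimpleGraph V} [G.LocallyFinite] (Φ : PlanarSkeletonNeg G) (t : V) (D : DataN V) (mk : ℕ)

/-- **`tanOff apron.ℓs apron.M ≤ j₀`** (p1-g11 2026-08-21T17:00:06Z). [folklore] -/
theorem j₀A_ge (A : ℤ) (r₀ : ℕ) : SkelI.tanOff (apron Φ t D mk A r₀).ℓs (apron Φ t D mk A r₀).M ≤ j₀A t D mk := by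
  rw [tanOff_apron]; rfl

/-- `j₀ ≤ j → tanOff ℓs M ≤ j`. [folklore] -/
theorem le_of_j₀A_le (A : ℤ) (r₀ : ℕ) {j : ℕ} (hj : j₀A t D mk ≤ j) : SkelI.tanOff (apron Φ t D mk A r₀).ℓs (apron Φ t D mk A r₀).M ≤ j :=
  (j₀A_ge Φ t D mk A r₀).trans hj

end Levels

/-! ## §2 The kit pair, oriented; the relative orientation `oS` -/

section KitO

variable (κ : Consts) {V : Type} [DecidableEq V] [Countable V] {G : SimpleGraph V} [G.LocallyFinite] (Φ : PlanarSkeletonNeg G) (t : V) (p : unitInterval)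
  (D DT : DataN V) (ori : V → ℕ → ℕ → Bool) (g f mk : ℕ)

/-- **The kit pair's orientation bit** `o_kit := ori t M_kit n_kit` (values at the merged record). [this work] -/
def oK : Bool := ori t (MK (D.orient DT ori) mk) (nKit (D.orient DT ori) mk)

/-- **The planar map the KIT PIECES live in**: `Φ.φ` or its transpose. [this work] -/
def φK : V → Site 2 := oriφ Φ.φ (oK t D DT ori mk)

omit [DecidableEq V] [Countable V] in
/-- `φK` is 1-Lipschitz. [folklore] -/
theorem lip_φK : Skelφ.Lip G (φK Φ t D DT ori mk) := Skelφ.lip_oriφ Φ.lip _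

omit [DecidableEq V] [Countable V] in
/-- `φK` has unit steps. [folklore] -/
theorem steps_φK : Skelφ.Steps G (φK Φ t D DT ori mk) := Skelφ.steps_oriφ Φ.step _

omit [DecidableEq V] [Countable V] [G.LocallyFinite] in
/-- `(φᵀ)ᵀ = φ`. [folklore] -/
theorem trφ_trφ (ψ : V → Site 2) : trφ (trφ ψ) = ψ := by
  funext w i; simp only [Skelφ.trφ_apply, Fin.rev_rev]

/-- **The RELATIVE orientation of the kit pair in the long run's frame** (p1's `ShortPcO.oS`: `true` = the run's map `φL`, `false` = `trφ φL`): `oS := (oK == oL)`. [this work] -/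
def oS : Bool := (oK t D DT ori mk == oL κ Φ t p D DT ori g f)

/-- **`oriφ φL oS = φK`**: the kit pieces, read in the run's chart with the flag `oS`, are the served ones. [folklore] -/
theorem oriφ_φL_oS : oriφ (φL κ Φ t p D DT ori g f) (oS κ Φ t p D DT ori g f mk) = φK Φ t D DT ori mk := by
  unfold oS φK φL
  cases oK t D DT ori mk <;> cases oL κ Φ t p D DT ori g f <;> simp [Skelφ.oriφ_true, Skelφ.oriφ_false, trφ_trφ]

omit [DecidableEq V] [Countable V] in
/-- **THE KIT PAIR's CLAUSE FROM `FactsO`** (map `φK`, `|h_kit| ≤ 10·n_kit`). [this work] -/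
theorem clauseK_of_factsO (hR : DT.R = D.R)
    (hfacts : ∀ M, D.M₀ ≤ M → ∀ n, D.n₁ M ≤ n →
      (ori t M n = true → D.EqGeom G Φ.φ t M n ∧ (D.hgt t M n).natAbs ≤ 10 * n) ∧
      (ori t M n = false → DT.EqGeom G (trφ Φ.φ) t M n ∧ (DT.hgt t M n).natAbs ≤ 10 * n)) :
    (D.orient DT ori).EqGeom G (φK Φ t D DT ori mk) t (MK (D.orient DT ori) mk) (nKit (D.orient DT ori) mk) ∧
      (hKit t (D.orient DT ori) mk).natAbs ≤ 10 * nKit (D.orient DT ori) mk :=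
  Skelφ.StepI.orient_clause_all hR hfacts _ (MK_facts _ mk).2.2.1 _ (nKit_facts _ mk).1

omit [DecidableEq V] [Countable V] in
/-- The kit pair's geometric facts unpacked (ℤ shapes), any map. [folklore] -/
theorem eqNumK_of_eqGeom (ψ : V → Site 2) (hE : D.EqGeom G ψ t (MK D mk) (nKit D mk)) :
    MK D mk < nKit D mk ∧ MK D mk < ℓKit t D mk ∧ |vKit t D mk| ≤ (nKit D mk : ℤ) ∧
      ((MK D mk : ℤ) + 1) * ((nKit D mk : ℤ) + |hKit t D mk|) ≤ (nKit D mk : ℤ) * ((ℓKit t D mk : ℤ) + 1) :=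
  eqGeom_num_of t D ψ hE

omit [DecidableEq V] [Countable V] in
/-- **p1's exit-table floor at the kit pair**: `24·M_u + 64 ≤ ℓ_kit` (from `M_kit < ℓ_kit`). [folklore] -/
theorem ℓKit_ge (ψ : V → Site 2) (hE : D.EqGeom G ψ t (MK D mk) (nKit D mk)) : 24 * Mu D + 64 ≤ ℓKit t D mk := by
  have h := (eqNumK_of_eqGeom t D mk ψ hE).2.1
  have h2 := (MK_facts D mk).2.1
  omega

/-- **THE ORIENTED SHORT-PIECE RECORD OF THE KIT PAIR** (p1's `ShortPcO`): `QK` + `oS`. [this work] -/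
def QKO : Skelφ.ShortPcO V := { QK t (D.orient DT ori) mk with oS := fun _ => oS κ Φ t p D DT ori g f mk }

/-- The fields of `QKO` (all `rfl`). [folklore] -/
theorem QKO_facts (c : V) : (QKO κ Φ t p D DT ori g f mk).nS c = nKit (D.orient DT ori) mk ∧ (QKO κ Φ t p D DT ori g f mk).hS c = hKit t (D.orient DT ori) mk ∧
    (QKO κ Φ t p D DT ori g f mk).ℓS c = ℓKit t (D.orient DT ori) mk ∧ (QKO κ Φ t p D DT ori g f mk).RS c = RK t (D.orient DT ori) mk ∧
    (QKO κ Φ t p D DT ori g f mk).vS c = vKit t (D.orient DT ori) mk ∧ (QKO κ Φ t p D DT ori g f mk).oS c = oS κ Φ t p D DT ori g f mk :=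
  ⟨rfl, rfl, rfl, rfl, rfl, rfl⟩

/-- **`RgO φL QKO c = RgK φK c`**: p1's oriented short region in the run's chart is the kit block's region over `φK`. [folklore] -/
theorem RgO_QKO (c : V) :
    Skelφ.RgO G (φL κ Φ t p D DT ori g f) (QKO κ Φ t p D DT ori g f mk) c = RgK G t (D.orient DT ori) mk (φK Φ t D DT ori mk) c := by
  unfold Skelφ.RgO RgK
  rw [show (QKO κ Φ t p D DT ori g f mk).oS c = oS κ Φ t p D DT ori g f mk from rfl, oriφ_φL_oS]
  rfl

end KitO

/-! ## §3 At `AtQO` of the S1 choices of record -/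

section AtQ

variable {κ : Consts} {V : Type} [DecidableEq V] [Countable V] {G : SimpleGraph V} [G.LocallyFinite] {Φ : PlanarSkeletonNeg G} {t : V} {p : unitInterval}
  {hC : Φ.CylSubcritical p} {gv fv : Neg.FSlot} {Pv : PSlot} {Sv : SSlot} {O : OutO V} {q : unitInterval} (mk : ℕ)

/-- **The kit pair's clause (map `φK`, `|h_kit| ≤ 10 n_kit`)** out of `AtQO`. [this work] -/
theorem clauseK_of_atQOS (hAt : (choiceAtOS κ Φ t p gv fv Sv hC Pv).AtQO O q) :
    O.merged.EqGeom G (φK Φ t O.D O.DT O.ori mk) t (MK O.merged mk) (nKit O.merged mk) ∧ (hKit t O.merged mk).natAbs ≤ 10 * nKit O.merged mk :=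
  clauseK_of_factsO Φ t O.D O.DT O.ori mk hAt.1.shared.2.2.1 hAt.1.clauses

/-- The ℤ form `|h_kit| ≤ 10·n_kit` (p1's `hκS`). [folklore] -/
theorem κK_int_of_atQOS (hAt : (choiceAtOS κ Φ t p gv fv Sv hC Pv).AtQO O q) : |hKit t O.merged mk| ≤ 10 * (nKit O.merged mk : ℤ) := by
  have h := (clauseK_of_atQOS mk hAt).2
  rw [← Int.natCast_natAbs]; exact_mod_cast h

/-- **THE THREE LEDGER FACTS OF `pexXO_spec` AT EVERY CENTRE** (`hnS`, `hκS`, `hℓ` for `Q := QKO`, `Mz := M_u`). [folklore] -/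
theorem pexXO_facts_of_atQOS {g f : ℕ} (hAt : (choiceAtOS κ Φ t p gv fv Sv hC Pv).AtQO O q) :
    (∀ c : V, 22 * Mu O.merged + 58 ≤ (QKO κ Φ t p O.D O.DT O.ori g f mk).nS c) ∧
      (∀ c : V, |(QKO κ Φ t p O.D O.DT O.ori g f mk).hS c| ≤ 10 * ((QKO κ Φ t p O.D O.DT O.ori g f mk).nS c : ℤ)) ∧
      (∀ c : V, 24 * Mu O.merged + 64 ≤ (QKO κ Φ t p O.D O.DT O.ori g f mk).ℓS c) :=
  ⟨fun _ => (nKit_facts O.merged mk).2.2.2.2, fun _ => κK_int_of_atQOS mk hAt, fun _ => ℓKit_ge t O.merged mk _ (clauseK_of_atQOS mk hAt).1⟩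

/-- **THE KIT PAIR's PIECE-LINKS at `q`** (map `φK`), given that the pair slot lists `(M_kit, n_kit)`. [this work] -/
theorem inputsK_of_atQOS (hAt : (choiceAtOS κ Φ t p gv fv Sv hC Pv).AtQO O q) (hP : (MK O.merged mk, nKit O.merged mk) ∈ (Pv κ Φ t p O.merged).1)
    (fam : Fin 2) (σ τ : ℤˣ) :
    1 - Neg.δI κ Φ <
      (bondPercolation G q).real (Skelφ.StepI.eventN G (φK Φ t O.D O.DT O.ori mk) O.merged (t, MK O.merged mk, some (nKit O.merged mk, fam, σ, τ))) :=
  inputsExtra_of_atQOS hAt hP fam σ τ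

/-- **The bridge clause at the slot values** out of `AtQO`. [this work] -/
theorem clauseBR_of_atQOS (hAt : (choiceAtOS κ Φ t p gv fv Sv hC Pv).AtQO O q) :
    O.merged.EqGeom G (φB Φ t O.D O.DT O.ori (mbR κ Φ t p O.merged mk) (bR κ Φ t p O.merged mk)) t (MBR κ Φ t p O.merged mk) (nBR κ Φ t p O.merged mk) ∧
      (hBR κ Φ t p O.merged mk).natAbs ≤ 10 * nBR κ Φ t p O.merged mk :=
  clauseB_of_factsO Φ t O.D O.DT O.ori _ _ hAt.1.shared.2.2.1 hAt.1.clauses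

/-- **The bridge pair's piece-links at the slot values**, given that the pair slot lists it. [this work] -/
theorem inputsBR_of_atQOS (hAt : (choiceAtOS κ Φ t p gv fv Sv hC Pv).AtQO O q)
    (hP : (MBR κ Φ t p O.merged mk, nBR κ Φ t p O.merged mk) ∈ (Pv κ Φ t p O.merged).1) (fam : Fin 2) (σ τ : ℤˣ) :
    1 - Neg.δI κ Φ <
      (bondPercolation G q).real (Skelφ.StepI.eventN G (φB Φ t O.D O.DT O.ori (mbR κ Φ t p O.merged mk) (bR κ Φ t p O.merged mk)) O.merged
        (t, MBR κ Φ t p O.merged mk, some (nBR κ Φ t p O.merged mk, fam, σ, τ))) :=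
  inputsExtra_of_atQOS hAt hP fam σ τ

end AtQ

end KS

end NegB

end PlanarSkeletonNeg

end Summit.CriticalPhenomena.PercolationContinuityZ3.Theorems.Transplant

end
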